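import Literature.NumberTheory.ComplexMultiplication.ParallelShadowsSlots
import Literature.NumberTheory.ComplexMultiplication.SharedImaginaryQuadraticDegenerate
import Literature.AlgebraicGeometry.Pohlmann1968.SeparatingCMFamilies
import HarnessLib

/-!
# Two CM fields over a COMMON SUBFIELD: types with proportional non-zero signatures over its places make every
# product of their abelian varieties stably degenerate (exceptional Hodge classes) — number-field dress of
# `ParallelShadowsSlots`

COR-CM (cell `pub-hodgecm2`, binder seat `b16` gen 49, count-neutral claim PARSHADOW, file F2; theorems only, no
definition, no named fact, no `sorry`).  NEW as stated, hence under `Summits/`.  HONEST FRAMING: statements about the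
Kubota–Dodson rank of families of CM types and the resulting EXCEPTIONAL (= not in the span of products of divisor
classes) Hodge classes on products of CM abelian varieties; these classes are not claimed algebraic or non-algebraic;
`HC_CM` is neither used nor asserted.

SETTING.  CM fields `K_i` (`i ∈ I`, finite), CM types `Φ_i`, two slots `i₀ ≠ i₁` and a number field `k` received by both,
`e₀ : k → K_{i₀}`, `e₁ : k → K_{i₁}`.  Over a complex place `z : k → ℂ` the type `Φ_{i_k}` has the SIGNATURE
`n_k(z) = #{φ ∈ Φ_{i_k} | φ ∘ e_k = z}` out of `f_k(z) = #{φ | φ ∘ e_k = z} = [K_{i_k} : k]` extensions, and the SHADOW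
`c_k(z) = 2 n_k(z) − f_k(z)` (`= Σ_{φ ∘ e_k = z} u_1(Φ_{i_k})(φ)`, `Shadow.fibreSum_antiVec_one_eq`); `c_k(z̄) = −c_k(z)`.

> **Theorem** (`cmFamilyRank_add_card_lt_of_parallel_signatures`, `not_isNondegenerateFamily_of_parallel_signatures`).
> If the shadows are PARALLEL and non-zero — `c₀ = q · c₁` for a rational `q`, `c₀(z₀) ≠ 0` for some place `z₀` — then
> `cmFamilyRank Φ + |I| < Σ_i cmTypeRank Φ_i + 1` and the family `Φ` is DEGENERATE, whatever the other slots and even if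
> every `Φ_i` is nondegenerate.  For SEPARATING families of realisations (e.g. simple, pairwise non-isogenous `A_i`) some
> product `⨁_j A_{π j}` carries a rational `(m,m)`-class outside `Dᵐ ⊗ ℂ` (`exists_exceptional_prod_of_parallel_signatures`).

The tree knew this for `k` IMAGINARY QUADRATIC (`SharedImaginaryQuadraticDegenerate`: there the shadow is a multiple of
`δ_z − δ_{z̄}`, so only `c_k ≠ 0` is asked) and for `k` (or a common normal subfield) with ABELIAN Galois group
(`SharedOddCharacterDegenerate`, `CommonAbelianCMSubfieldDegenerate`: odd characters); here `k` is ANY number field —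
e.g. a non-Galois quartic CM field inside two octic CM fields (file F3 `CommonQuarticCMSubfieldFourfolds`), where no odd
character and no partial conjugation is available and the answer genuinely depends on the types.

Also: **Yanai for pairs** (`not_isNondegenerateFamily_of_multiplicities`): `k` a CM field, `S₁` a CM type of `k`,
`Φ_{i₀}` lying over `S₁` with multiplicities `(a₀, b₀)` and `Φ_{i₁}` over THE SAME `S₁` with `(a₁, b₁)`, `a₀ ≠ b₀`,
`a₁ ≠ b₁` ⟹ the family is degenerate (Gordon 9.4.3 is the one-type statement); **equal signatures**
(`not_isNondegenerateFamily_of_signatures_eq`: `n₀ = n₁`, `f₀ = f₁`, some `2 n₀(z₀) ≠ f₀(z₀)`); and the reflex-field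
consequence `not_exists_smul_eq_conj_of_parallel_signatures`: for a two-slot family with parallel non-zero shadows no
automorphism of `ℂ` in the subgroup generated by the two type stabilisers is complex conjugation on `Hom(K_{i₀}, ℂ)` —
the reflex fields `K_{i₀}*`, `K_{i₁}*` do NOT meet in a totally real field (contrapositive of the tree's
`CMTypeRankStabilizerClosure` / `ReflexFieldsMeetRealCMHodge`).

## References

* [Gordon1999HodgeAVSurvey] B. B. Gordon, *A survey of the Hodge conjecture for abelian varieties*, §3 Theorem (proof),
  7.4–7.7 (Murty, Hazama: degenerate ⟺ exceptional classes on some power/product), 9.4.3 (Yanai's theorem).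
* [Deligne1982HodgeCycles] P. Deligne, *Hodge cycles on abelian varieties*, LNM 900 (1982), I Ex. 3.7, §4.
* [Shimura1998] G. Shimura, *Abelian Varieties with Complex Multiplication and Modular Functions*, §8.3 (reflex field =
  fixed field of the stabiliser of the type), §18.1.

Provenance: Literature home (namespace `Literature.AlgebraicGeometry.ComplexMultiplication.ParallelShadowsCMFieldsHodge`) of the Summits-side `CorCM/ParallelShadowsCMFieldsHodge` (cell `pub-hodgecm2`, COR-CM; all its imports are `Literature/`, Mathlib and the already re-homed `ParallelShadowsSlots`), which `Literature/` may not import; theorems only, no named fact, no definition. Nothing here bears on `HC_CM`. Lane `lit-hodgefound` (Layer A3: CM types, their Kubota ranks and Galois combinatorics), seat p20.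
-/

set_option autoImplicit false

noncomputable section

open scoped BigOperators
open _root_.CategoryTheory _root_.CategoryTheory.Limits NumberField NumberField.ComplexEmbedding Module

namespace Literature.AlgebraicGeometry.ComplexMultiplication.ParallelShadowsCMFieldsHodge

open Literature.NumberTheory.ComplexMultiplication.Shadow

open Literature.NumberTheory.ComplexMultiplication
open Literature.AlgebraicGeometry.Motives (AbelianVariety CMType)
open Literature.AlgebraicGeometry.HodgeTheory
open Literature.AlgebraicGeometry.ComplexMultiplication (IsCMTypeRealisation)
open Literature.AlgebraicGeometry.VanGeemen1994 (hodgeClassSpan)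
open Literature.AlgebraicGeometry.Pohlmann1968
open Literature.Barriers.HodgeConjecture (divisorClassesSpan)
open scoped Classical

/-! ### §1 The shadow of a CM type on a subfield: signatures over the places -/

section OneField

variable {k K : Type} [Field k] [Field K]

/-- Restriction of embeddings to a subfield is `Aut(ℂ)`-equivariant: `(g ∘ φ) ∘ e = g ∘ (φ ∘ e)`. [cite: Gordon1999HodgeAVSurvey, 7.5–7.7 and 9.4.3] -/
theorem smul_comp_ringHom (g : ℂ ≃+* ℂ) (φ : K →+* ℂ) (e : k →+* K) : (g • φ).comp e = g • φ.comp e := rfl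

variable [NumberField K]

/-- **The shadow is the signature**: `Σ_{φ ∘ e = z} u_1(Φ)(φ) = 2 · #{φ ∈ Φ | φ ∘ e = z} − #{φ | φ ∘ e = z}`.
[cite: Gordon1999HodgeAVSurvey, 9.4.3] -/
theorem shadow_eq_two_mul_card_sub_card (Φ : CMType K) (e : k →+* K) (z : k →+* ℂ) :
    ∑ φ ∈ Finset.univ.filter (fun φ : K →+* ℂ => φ.comp e = z), antiVec Φ.1 (1 : ℂ ≃+* ℂ) φ =
      2 * ((Finset.univ.filter fun φ : K →+* ℂ => φ.comp e = z ∧ φ ∈ Φ.1).card : ℚ) -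
        ((Finset.univ.filter fun φ : K →+* ℂ => φ.comp e = z).card : ℚ) :=
  Shadow.fibreSum_antiVec_one_eq (G := ℂ ≃+* ℂ) (fun φ : K →+* ℂ => φ.comp e) Φ.1 z

end OneField

/-! ### §2 Parallel non-zero signatures over a common subfield: the family is degenerate -/

section Family

variable {I : Type} {K : I → Type} [∀ i, Field (K i)] [∀ i, NumberField (K i)] [∀ i, IsCMField (K i)] [Fintype I]
  [Nonempty I]
variable {k : Type} [Field k]

omit [Nonempty I] in
/-- Bookkeeping: a strict rank defect `cmFamilyRank Φ + |I| < Σ_i cmTypeRank Φ_i + 1` makes the family degenerate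
(`cmTypeRank Φ_i ≤ [K_i:ℚ]/2 + 1` termwise, all degrees even). [cite: Gordon1999HodgeAVSurvey, 7.5–7.7] -/
theorem not_isNondegenerateFamily_of_cmFamilyRank_add_card_lt (Φ : ∀ i, CMType (K i))
    (hlt : CMAlgebra.cmFamilyRank Φ + Fintype.card I < (∑ i, cmTypeRank (Φ i)) + 1) :
    ¬ CMAlgebra.IsNondegenerateFamily Φ := by
  intro hnd
  rw [CMAlgebra.isNondegenerateFamily_iff] at hnd
  have hle : ∀ i, cmTypeRank (Φ i) ≤ finrank ℚ (K i) / 2 + 1 := fun i => cmTypeRank_le (Φ i)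
  have hsum : ∑ i, cmTypeRank (Φ i) ≤ ∑ i, (finrank ℚ (K i) / 2 + 1) := Finset.sum_le_sum fun i _ => hle i
  rw [Finset.sum_add_distrib, Finset.sum_const, Finset.card_univ, smul_eq_mul, mul_one] at hsum
  have hev : ∀ i ∈ (Finset.univ : Finset I), 2 ∣ finrank ℚ (K i) := fun i _ =>
    ⟨(Finset.univ.filter (fun φ : K i →+* ℂ => φ ∈ (Φ i).1)).card, (two_mul_card_filter_mem_cmType (Φ i)).symm⟩
  have hdiv : (∑ i, finrank ℚ (K i)) / 2 = ∑ i, finrank ℚ (K i) / 2 := by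
    rw [Nat.div_eq_iff_eq_mul_left two_pos (Finset.dvd_sum hev), Finset.sum_mul]
    exact Finset.sum_congr rfl fun i hi => (Nat.div_mul_cancel (hev i hi)).symm
  rw [hdiv] at hnd
  omega

/-- **Parallel non-zero signatures over a common subfield ⟹ the rank is not additive.**  With
`n_k(z) = #{φ ∈ Φ_{i_k} | φ ∘ e_k = z}`, `f_k(z) = #{φ | φ ∘ e_k = z}`: if `2 n₀(z) − f₀(z) = q · (2 n₁(z) − f₁(z))` for
every place `z : k → ℂ` and `2 n₀(z₀) ≠ f₀(z₀)` for one, then `cmFamilyRank Φ + |I| < Σ_i cmTypeRank Φ_i + 1`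
(`rank Hg(∏ A_i) < Σ rank Hg(A_i)`). [cite: Gordon1999HodgeAVSurvey, §3 Theorem (proof), 7.5 and 9.4.3] -/
theorem cmFamilyRank_add_card_lt_of_parallel_signatures {i₀ i₁ : I} (h01 : i₀ ≠ i₁) (e₀ : k →+* K i₀)
    (e₁ : k →+* K i₁) (Φ : ∀ i, CMType (K i)) (q : ℚ)
    (hpar : ∀ z : k →+* ℂ,
      2 * ((Finset.univ.filter fun φ : K i₀ →+* ℂ => φ.comp e₀ = z ∧ φ ∈ (Φ i₀).1).card : ℚ) -
          ((Finset.univ.filter fun φ : K i₀ →+* ℂ => φ.comp e₀ = z).card : ℚ) =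
        q * (2 * ((Finset.univ.filter fun φ : K i₁ →+* ℂ => φ.comp e₁ = z ∧ φ ∈ (Φ i₁).1).card : ℚ) -
          ((Finset.univ.filter fun φ : K i₁ →+* ℂ => φ.comp e₁ = z).card : ℚ)))
    {z₀ : k →+* ℂ}
    (hz₀ : 2 * (Finset.univ.filter fun φ : K i₀ →+* ℂ => φ.comp e₀ = z₀ ∧ φ ∈ (Φ i₀).1).card ≠
      (Finset.univ.filter fun φ : K i₀ →+* ℂ => φ.comp e₀ = z₀).card) :
    CMAlgebra.cmFamilyRank Φ + Fintype.card I < (∑ i, cmTypeRank (Φ i)) + 1 := by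
  refine Shadow.typeRank_sigmaType_add_card_lt_of_parallel_fibreSum (G := ℂ ≃+* ℂ) (Φ := fun i => (Φ i).1)
    (fun i => isCMTypeWith_conj (Φ i)) h01 (fun φ : K i₀ →+* ℂ => φ.comp e₀) (fun φ : K i₁ →+* ℂ => φ.comp e₁)
    (fun _ _ => rfl) (fun _ _ => rfl) q (fun z => ?_) (z₀ := z₀) ?_
  · rw [shadow_eq_two_mul_card_sub_card (Φ i₀) e₀ z, shadow_eq_two_mul_card_sub_card (Φ i₁) e₁ z]
    exact hpar z
  · rw [shadow_eq_two_mul_card_sub_card (Φ i₀) e₀ z₀]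
    intro h
    apply hz₀
    have h' : (2 * ((Finset.univ.filter fun φ : K i₀ →+* ℂ => φ.comp e₀ = z₀ ∧ φ ∈ (Φ i₀).1).card : ℚ)) =
        ((Finset.univ.filter fun φ : K i₀ →+* ℂ => φ.comp e₀ = z₀).card : ℚ) := sub_eq_zero.1 h
    exact_mod_cast h'

/-- **Parallel non-zero signatures over a common subfield ⟹ the family is DEGENERATE** (`¬ IsNondegenerateFamily Φ`),
whatever the other slots and even if every member is nondegenerate. [cite: Gordon1999HodgeAVSurvey, 7.5–7.7 and 9.4.3] -/
theorem not_isNondegenerateFamily_of_parallel_signatures {i₀ i₁ : I} (h01 : i₀ ≠ i₁) (e₀ : k →+* K i₀)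
    (e₁ : k →+* K i₁) (Φ : ∀ i, CMType (K i)) (q : ℚ)
    (hpar : ∀ z : k →+* ℂ,
      2 * ((Finset.univ.filter fun φ : K i₀ →+* ℂ => φ.comp e₀ = z ∧ φ ∈ (Φ i₀).1).card : ℚ) -
          ((Finset.univ.filter fun φ : K i₀ →+* ℂ => φ.comp e₀ = z).card : ℚ) =
        q * (2 * ((Finset.univ.filter fun φ : K i₁ →+* ℂ => φ.comp e₁ = z ∧ φ ∈ (Φ i₁).1).card : ℚ) -
          ((Finset.univ.filter fun φ : K i₁ →+* ℂ => φ.comp e₁ = z).card : ℚ)))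
    {z₀ : k →+* ℂ}
    (hz₀ : 2 * (Finset.univ.filter fun φ : K i₀ →+* ℂ => φ.comp e₀ = z₀ ∧ φ ∈ (Φ i₀).1).card ≠
      (Finset.univ.filter fun φ : K i₀ →+* ℂ => φ.comp e₀ = z₀).card) :
    ¬ CMAlgebra.IsNondegenerateFamily Φ :=
  not_isNondegenerateFamily_of_cmFamilyRank_add_card_lt Φ
    (cmFamilyRank_add_card_lt_of_parallel_signatures h01 e₀ e₁ Φ q hpar hz₀)

/-- **EQUAL signatures**: if `n₀(z) = n₁(z)` and `f₀(z) = f₁(z)` for every place `z` of the common subfield (e.g.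
`[K_{i₀} : k] = [K_{i₁} : k]` and the two types have the same multiplicities over every place) and some `2 n₀(z₀) ≠ f₀(z₀)`,
the family is degenerate. [cite: Gordon1999HodgeAVSurvey, 7.5–7.7 and 9.4.3] -/
theorem not_isNondegenerateFamily_of_signatures_eq {i₀ i₁ : I} (h01 : i₀ ≠ i₁) (e₀ : k →+* K i₀) (e₁ : k →+* K i₁)
    (Φ : ∀ i, CMType (K i))
    (hn : ∀ z : k →+* ℂ, (Finset.univ.filter fun φ : K i₀ →+* ℂ => φ.comp e₀ = z ∧ φ ∈ (Φ i₀).1).card =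
      (Finset.univ.filter fun φ : K i₁ →+* ℂ => φ.comp e₁ = z ∧ φ ∈ (Φ i₁).1).card)
    (hf : ∀ z : k →+* ℂ, (Finset.univ.filter fun φ : K i₀ →+* ℂ => φ.comp e₀ = z).card =
      (Finset.univ.filter fun φ : K i₁ →+* ℂ => φ.comp e₁ = z).card)
    {z₀ : k →+* ℂ}
    (hz₀ : 2 * (Finset.univ.filter fun φ : K i₀ →+* ℂ => φ.comp e₀ = z₀ ∧ φ ∈ (Φ i₀).1).card ≠
      (Finset.univ.filter fun φ : K i₀ →+* ℂ => φ.comp e₀ = z₀).card) :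
    ¬ CMAlgebra.IsNondegenerateFamily Φ :=
  not_isNondegenerateFamily_of_parallel_signatures h01 e₀ e₁ Φ 1 (fun z => by rw [hn z, hf z, one_mul]) hz₀

/-- **The reflex fields do not meet in a totally real field.**  For a two-slot family with parallel non-zero
signatures, no automorphism of `ℂ` in the subgroup generated by the two type stabilisers acts on `Hom(K_{i₀}, ℂ)` as
complex conjugation (contrapositive of the tree's stabiliser-closure additivity criterion; `Stab Φ = Aut(ℂ/K*)`).
[cite: Shimura1998, §8.3] [cite: Gordon1999HodgeAVSurvey, §3 Theorem (proof)] -/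
theorem not_exists_smul_eq_conj_of_parallel_signatures {i₀ i₁ : I} (hI : ∀ j, j = i₀ ∨ j = i₁) (h01 : i₀ ≠ i₁)
    (e₀ : k →+* K i₀) (e₁ : k →+* K i₁) (Φ : ∀ i, CMType (K i)) (q : ℚ)
    (hpar : ∀ z : k →+* ℂ,
      2 * ((Finset.univ.filter fun φ : K i₀ →+* ℂ => φ.comp e₀ = z ∧ φ ∈ (Φ i₀).1).card : ℚ) -
          ((Finset.univ.filter fun φ : K i₀ →+* ℂ => φ.comp e₀ = z).card : ℚ) =
        q * (2 * ((Finset.univ.filter fun φ : K i₁ →+* ℂ => φ.comp e₁ = z ∧ φ ∈ (Φ i₁).1).card : ℚ) -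
          ((Finset.univ.filter fun φ : K i₁ →+* ℂ => φ.comp e₁ = z).card : ℚ)))
    {z₀ : k →+* ℂ}
    (hz₀ : 2 * (Finset.univ.filter fun φ : K i₀ →+* ℂ => φ.comp e₀ = z₀ ∧ φ ∈ (Φ i₀).1).card ≠
      (Finset.univ.filter fun φ : K i₀ →+* ℂ => φ.comp e₀ = z₀).card) :
    ¬ ∃ g ∈ Subgroup.closure
        ({s : ℂ ≃+* ℂ | ∀ x : K i₀ →+* ℂ, s • x ∈ (Φ i₀).1 ↔ x ∈ (Φ i₀).1} ∪
          {s : ℂ ≃+* ℂ | ∀ y : K i₁ →+* ℂ, s • y ∈ (Φ i₁).1 ↔ y ∈ (Φ i₁).1}),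
      ∀ x : K i₀ →+* ℂ, g • x = (starRingAut : ℂ ≃+* ℂ) • x := by
  refine Shadow.not_exists_smul_eq_rho_of_parallel_fibreSum (G := ℂ ≃+* ℂ) (Φ := fun i => (Φ i).1)
    (fun i => isCMTypeWith_conj (Φ i)) hI h01 (fun φ : K i₀ →+* ℂ => φ.comp e₀) (fun φ : K i₁ →+* ℂ => φ.comp e₁)
    (fun _ _ => rfl) (fun _ _ => rfl) q (fun z => ?_) (z₀ := z₀) ?_
  · rw [shadow_eq_two_mul_card_sub_card (Φ i₀) e₀ z, shadow_eq_two_mul_card_sub_card (Φ i₁) e₁ z]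
    exact hpar z
  · rw [shadow_eq_two_mul_card_sub_card (Φ i₀) e₀ z₀]
    intro h
    apply hz₀
    have h' : (2 * ((Finset.univ.filter fun φ : K i₀ →+* ℂ => φ.comp e₀ = z₀ ∧ φ ∈ (Φ i₀).1).card : ℚ)) =
        ((Finset.univ.filter fun φ : K i₀ →+* ℂ => φ.comp e₀ = z₀).card : ℚ) := sub_eq_zero.1 h
    exact_mod_cast h'

end Family

/-! ### §3 Yanai for pairs: two types over the same type of a common CM subfield with unequal multiplicities -/

section Yanai

variable {I : Type} {K : I → Type} [∀ i, Field (K i)] [∀ i, NumberField (K i)] [∀ i, IsCMField (K i)] [Fintype I]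
  [Nonempty I]
variable {k : Type} [Field k] [NumberField k] [IsCMField k]

/-- **Yanai for pairs.**  `k` a CM field received by `K_{i₀}` and `K_{i₁}` (`i₀ ≠ i₁`), `S₁` a CM type of `k`; suppose
`Φ_{i₀}` lies over `S₁` with multiplicities `(a₀, b₀)` (`a₀` extensions of each `z ∈ S₁` and `b₀` of each `z ∉ S₁` belong
to `Φ_{i₀}`) and `Φ_{i₁}` over THE SAME `S₁` with multiplicities `(a₁, b₁)`.  If `a₀ ≠ b₀` and `a₁ ≠ b₁`, the rank is not
additive: `cmFamilyRank Φ + |I| < Σ_i cmTypeRank Φ_i + 1`.  (Gordon 9.4.3 / Yanai: ONE such type is degenerate when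
`a = b` or `S₁` is; here `Φ_{i₀}`, `Φ_{i₁}`, `S₁` may all be nondegenerate — e.g. `a_k = [K_{i_k} : k]`, `b_k = 0`: two
types INDUCED from the same type of `k`.) [cite: Gordon1999HodgeAVSurvey, 9.4.3 and 7.5] -/
theorem cmFamilyRank_add_card_lt_of_multiplicities {i₀ i₁ : I} (h01 : i₀ ≠ i₁) (e₀ : k →+* K i₀) (e₁ : k →+* K i₁)
    (Φ : ∀ i, CMType (K i)) (S₁ : CMType k) {a₀ b₀ a₁ b₁ : ℕ}
    (hm₀ : ∀ z : k →+* ℂ, (Finset.univ.filter fun φ : K i₀ →+* ℂ => φ.comp e₀ = z ∧ φ ∈ (Φ i₀).1).card =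
      if z ∈ S₁.1 then a₀ else b₀)
    (hm₁ : ∀ z : k →+* ℂ, (Finset.univ.filter fun φ : K i₁ →+* ℂ => φ.comp e₁ = z ∧ φ ∈ (Φ i₁).1).card =
      if z ∈ S₁.1 then a₁ else b₁)
    (h₀ : a₀ ≠ b₀) (h₁ : a₁ ≠ b₁) :
    CMAlgebra.cmFamilyRank Φ + Fintype.card I < (∑ i, cmTypeRank (Φ i)) + 1 :=
  Shadow.typeRank_sigmaType_add_card_lt_of_multiplicities (G := ℂ ≃+* ℂ) (Φ := fun i => (Φ i).1)
    (fun i => isCMTypeWith_conj (Φ i)) h01 (isCMTypeWith_conj S₁) (fun φ : K i₀ →+* ℂ => φ.comp e₀)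
    (fun φ : K i₁ →+* ℂ => φ.comp e₁) (fun _ _ => rfl) (fun _ _ => rfl) hm₀ hm₁ h₀ h₁

/-- **Yanai for pairs, degeneracy form**: under the hypotheses of `cmFamilyRank_add_card_lt_of_multiplicities` the
family `Φ` is DEGENERATE; on abelian varieties some `∏_i A_i^{k_i}` carries an exceptional Hodge class (§4).
[cite: Gordon1999HodgeAVSurvey, 9.4.3 and 7.5–7.7] -/
theorem not_isNondegenerateFamily_of_multiplicities {i₀ i₁ : I} (h01 : i₀ ≠ i₁) (e₀ : k →+* K i₀)
    (e₁ : k →+* K i₁) (Φ : ∀ i, CMType (K i)) (S₁ : CMType k) {a₀ b₀ a₁ b₁ : ℕ}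
    (hm₀ : ∀ z : k →+* ℂ, (Finset.univ.filter fun φ : K i₀ →+* ℂ => φ.comp e₀ = z ∧ φ ∈ (Φ i₀).1).card =
      if z ∈ S₁.1 then a₀ else b₀)
    (hm₁ : ∀ z : k →+* ℂ, (Finset.univ.filter fun φ : K i₁ →+* ℂ => φ.comp e₁ = z ∧ φ ∈ (Φ i₁).1).card =
      if z ∈ S₁.1 then a₁ else b₁)
    (h₀ : a₀ ≠ b₀) (h₁ : a₁ ≠ b₁) : ¬ CMAlgebra.IsNondegenerateFamily Φ :=
  not_isNondegenerateFamily_of_cmFamilyRank_add_card_lt Φ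
    (cmFamilyRank_add_card_lt_of_multiplicities h01 e₀ e₁ Φ S₁ hm₀ hm₁ h₀ h₁)

end Yanai

/-! ### §4 On abelian varieties: exceptional Hodge classes on a product -/

section Varieties

variable {I : Type} {K : I → Type} [∀ i, Field (K i)] [∀ i, NumberField (K i)] [∀ i, IsCMField (K i)] [Fintype I]
  [Nonempty I] {Φ : ∀ i, CMType (K i)}
variable {A : I → AbelianVariety ℂ} {ι : ∀ i, 𝓞 (K i) →+* End (A i)}
  {θ : ∀ i, K i →+* Module.End ℂ (complexBetti (A i).X 1)}
variable {k : Type} [Field k]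

/-- **Parallel non-zero signatures over a common subfield force an exceptional Hodge class** on some product
`⨁_{j<N} A_{π j}` of a SEPARATING family of realisations (a rational `(m,m)`-class outside `Dᵐ ⊗ ℂ`; not claimed algebraic
or not): degenerate separating families have exceptional classes (Hazama–Murty, tree
`exists_exceptional_prod_of_not_isNondegenerateFamily`). [cite: Gordon1999HodgeAVSurvey, 7.4–7.6.1 and 9.4.3] -/
theorem exists_exceptional_prod_of_parallel_signatures (hsep : CMAlgebra.IsSeparatingFamily Φ) {i₀ i₁ : I}
    (h01 : i₀ ≠ i₁) (e₀ : k →+* K i₀) (e₁ : k →+* K i₁) (q : ℚ)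
    (hpar : ∀ z : k →+* ℂ,
      2 * ((Finset.univ.filter fun φ : K i₀ →+* ℂ => φ.comp e₀ = z ∧ φ ∈ (Φ i₀).1).card : ℚ) -
          ((Finset.univ.filter fun φ : K i₀ →+* ℂ => φ.comp e₀ = z).card : ℚ) =
        q * (2 * ((Finset.univ.filter fun φ : K i₁ →+* ℂ => φ.comp e₁ = z ∧ φ ∈ (Φ i₁).1).card : ℚ) -
          ((Finset.univ.filter fun φ : K i₁ →+* ℂ => φ.comp e₁ = z).card : ℚ)))
    {z₀ : k →+* ℂ}
    (hz₀ : 2 * (Finset.univ.filter fun φ : K i₀ →+* ℂ => φ.comp e₀ = z₀ ∧ φ ∈ (Φ i₀).1).card ≠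
      (Finset.univ.filter fun φ : K i₀ →+* ℂ => φ.comp e₀ = z₀).card)
    (hA : ∀ i, IsCMTypeRealisation (Φ i) (A i) (ι i) (θ i)) :
    ∃ (N : ℕ) (π : Fin N → I) (m : ℕ) (c : complexBetti (⨁ fun j : Fin N => A (π j)).X (2 * m)),
      IsRationalClass c ∧
      IsOfHodgeType (⨁ fun j : Fin N => A (π j)).dim (⨁ fun j : Fin N => A (π j)).X (2 * m) m m c ∧
      c ∉ divisorClassesSpan (⨁ fun j : Fin N => A (π j)).X (⨁ fun j : Fin N => A (π j)).dim m :=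
  CMAlgebra.exists_exceptional_prod_of_not_isNondegenerateFamily hsep
    (not_isNondegenerateFamily_of_parallel_signatures h01 e₀ e₁ Φ q hpar hz₀) hA

/-- **`B• = D•` fails on some product** of a separating family two of whose types cast parallel non-zero shadows on a
common subfield. [cite: Gordon1999HodgeAVSurvey, 7.5 and 7.6.1] -/
theorem not_forall_prod_hodgeClassSpan_eq_of_parallel_signatures (hsep : CMAlgebra.IsSeparatingFamily Φ) {i₀ i₁ : I}
    (h01 : i₀ ≠ i₁) (e₀ : k →+* K i₀) (e₁ : k →+* K i₁) (q : ℚ)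
    (hpar : ∀ z : k →+* ℂ,
      2 * ((Finset.univ.filter fun φ : K i₀ →+* ℂ => φ.comp e₀ = z ∧ φ ∈ (Φ i₀).1).card : ℚ) -
          ((Finset.univ.filter fun φ : K i₀ →+* ℂ => φ.comp e₀ = z).card : ℚ) =
        q * (2 * ((Finset.univ.filter fun φ : K i₁ →+* ℂ => φ.comp e₁ = z ∧ φ ∈ (Φ i₁).1).card : ℚ) -
          ((Finset.univ.filter fun φ : K i₁ →+* ℂ => φ.comp e₁ = z).card : ℚ)))
    {z₀ : k →+* ℂ}
    (hz₀ : 2 * (Finset.univ.filter fun φ : K i₀ →+* ℂ => φ.comp e₀ = z₀ ∧ φ ∈ (Φ i₀).1).card ≠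
      (Finset.univ.filter fun φ : K i₀ →+* ℂ => φ.comp e₀ = z₀).card)
    (hA : ∀ i, IsCMTypeRealisation (Φ i) (A i) (ι i) (θ i)) :
    ¬ ∀ (N : ℕ) (π : Fin N → I) (m : ℕ),
      hodgeClassSpan (⨁ fun j : Fin N => A (π j)).dim (⨁ fun j : Fin N => A (π j)).X m =
        divisorClassesSpan (⨁ fun j : Fin N => A (π j)).X (⨁ fun j : Fin N => A (π j)).dim m := fun h =>
  not_isNondegenerateFamily_of_parallel_signatures h01 e₀ e₁ Φ q hpar hz₀
    ((CMAlgebra.isNondegenerateFamily_iff_forall_prod_hodgeClassSpan_eq hsep hA).2 h)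

/-- **Two SIMPLE, NON-ISOGENOUS CM abelian varieties whose CM fields receive a common number field `k` over whose
places the two types have parallel non-zero shadows carry an exceptional Hodge class on some `A₀^a × A₁^b`**
(some `⨁_{j<N} A_{π j}`) — in every dimension. [cite: Gordon1999HodgeAVSurvey, 7.4–7.6.1 and 9.4.3] -/
theorem exists_exceptional_prod_of_isSimple_of_parallel_signatures {i₀ i₁ : I} (h01 : i₀ ≠ i₁) (e₀ : k →+* K i₀)
    (e₁ : k →+* K i₁) (q : ℚ)
    (hpar : ∀ z : k →+* ℂ,
      2 * ((Finset.univ.filter fun φ : K i₀ →+* ℂ => φ.comp e₀ = z ∧ φ ∈ (Φ i₀).1).card : ℚ) -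
          ((Finset.univ.filter fun φ : K i₀ →+* ℂ => φ.comp e₀ = z).card : ℚ) =
        q * (2 * ((Finset.univ.filter fun φ : K i₁ →+* ℂ => φ.comp e₁ = z ∧ φ ∈ (Φ i₁).1).card : ℚ) -
          ((Finset.univ.filter fun φ : K i₁ →+* ℂ => φ.comp e₁ = z).card : ℚ)))
    {z₀ : k →+* ℂ}
    (hz₀ : 2 * (Finset.univ.filter fun φ : K i₀ →+* ℂ => φ.comp e₀ = z₀ ∧ φ ∈ (Φ i₀).1).card ≠
      (Finset.univ.filter fun φ : K i₀ →+* ℂ => φ.comp e₀ = z₀).card)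
    (hA : ∀ i, IsCMTypeRealisation (Φ i) (A i) (ι i) (θ i)) (hs : ∀ i, (A i).IsSimple)
    (hniso : ∀ i j, i ≠ j → ¬ AbelianVariety.IsIsogenous (A i) (A j)) :
    ∃ (N : ℕ) (π : Fin N → I) (m : ℕ) (c : complexBetti (⨁ fun j : Fin N => A (π j)).X (2 * m)),
      IsRationalClass c ∧
      IsOfHodgeType (⨁ fun j : Fin N => A (π j)).dim (⨁ fun j : Fin N => A (π j)).X (2 * m) m m c ∧
      c ∉ divisorClassesSpan (⨁ fun j : Fin N => A (π j)).X (⨁ fun j : Fin N => A (π j)).dim m :=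
  exists_exceptional_prod_of_parallel_signatures
    (CMAlgebra.isSeparatingFamily_of_isSimple_of_pairwise_not_isIsogenous hA hs hniso) h01 e₀ e₁ q hpar hz₀ hA

variable [NumberField k] [IsCMField k]

/-- **Yanai for pairs on abelian varieties**: two SIMPLE, NON-ISOGENOUS CM abelian varieties with CM by
`K_{i₀} ⊇ k ⊆ K_{i₁}`, `k` a CM field, whose types lie over ONE CM type `S₁` of `k` with multiplicities `(a₀, b₀)`,
`(a₁, b₁)`, `a₀ ≠ b₀`, `a₁ ≠ b₁`, carry an exceptional Hodge class on some `A₀^a × A₁^b` — e.g. primitive types with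
multiplicities `(2, 1)` over one type of `k` on two cubic extensions of `k` (induced types, `b = 0`, are never simple).
[cite: Gordon1999HodgeAVSurvey, 9.4.3 and 7.4–7.6.1] -/
theorem exists_exceptional_prod_of_isSimple_of_multiplicities {i₀ i₁ : I} (h01 : i₀ ≠ i₁) (e₀ : k →+* K i₀)
    (e₁ : k →+* K i₁) (S₁ : CMType k) {a₀ b₀ a₁ b₁ : ℕ}
    (hm₀ : ∀ z : k →+* ℂ, (Finset.univ.filter fun φ : K i₀ →+* ℂ => φ.comp e₀ = z ∧ φ ∈ (Φ i₀).1).card =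
      if z ∈ S₁.1 then a₀ else b₀)
    (hm₁ : ∀ z : k →+* ℂ, (Finset.univ.filter fun φ : K i₁ →+* ℂ => φ.comp e₁ = z ∧ φ ∈ (Φ i₁).1).card =
      if z ∈ S₁.1 then a₁ else b₁)
    (h₀ : a₀ ≠ b₀) (h₁ : a₁ ≠ b₁) (hA : ∀ i, IsCMTypeRealisation (Φ i) (A i) (ι i) (θ i))
    (hs : ∀ i, (A i).IsSimple) (hniso : ∀ i j, i ≠ j → ¬ AbelianVariety.IsIsogenous (A i) (A j)) :
    ∃ (N : ℕ) (π : Fin N → I) (m : ℕ) (c : complexBetti (⨁ fun j : Fin N => A (π j)).X (2 * m)),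
      IsRationalClass c ∧
      IsOfHodgeType (⨁ fun j : Fin N => A (π j)).dim (⨁ fun j : Fin N => A (π j)).X (2 * m) m m c ∧
      c ∉ divisorClassesSpan (⨁ fun j : Fin N => A (π j)).X (⨁ fun j : Fin N => A (π j)).dim m :=
  CMAlgebra.exists_exceptional_prod_of_not_isNondegenerateFamily
    (CMAlgebra.isSeparatingFamily_of_isSimple_of_pairwise_not_isIsogenous hA hs hniso)
    (not_isNondegenerateFamily_of_multiplicities h01 e₀ e₁ Φ S₁ hm₀ hm₁ h₀ h₁) hA

end Varieties

end Literature.AlgebraicGeometry.ComplexMultiplication.ParallelShadowsCMFieldsHodge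

end
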